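import Literature.NumberTheory.EllipticCurves.PadicFiltrationIndexProofs
import Literature.NumberTheory.EllipticCurves.ComplexMultiplicationCoatesWilesSeparationProofs
import HarnessLib

/-!
# `E⁽ᵏ⁺¹⁾(ℚ_p) = p·E⁽ᵏ⁾(ℚ_p)` for `k ≥ 1` and `p` odd (AEC IV.6.4 (b) in divisibility form), and the
# `n`-trick: `P ∈ p^j·E(ℚ_p) ⟺ n·P ∈ E⁽ʲ⁺¹⁾` when `p ∤ n`, `n·E(ℚ_p) ⊆ E₁(ℚ_p)` (PROVED; local theory)

HONEST FRAMING (cell `b2b-bsdres`, run/shared/lean/b2b/bsd-rank1-residual/, verbatim in every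
file): the goal of the cell is to DELETE the COMBINATION-SHAPED residual classes of the
Birch–Swinnerton-Dyer formula for ALL analytic-rank `≤ 1` elliptic curves over `ℚ` — "full BSD
formula for every rank `≤ 1` curve in class `C`" assembled STRICTLY from published theorems — so
that the rank-`≤ 1` remainder becomes exactly the CONSTRUCTION-SHAPED classes, which are TYPED
(missing-input `Prop`s), NOT attempted. This is not "finishing BSD". Seat `b2b-bsdres-additive-p3`
(typer-designate for the cell conjecture C-16, hyp R-16 (e)). THEOREMS ONLY (no definition, no named
fact) about a `p`-integral elliptic Weierstrass equation over `ℚ_p`, read through the tree's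
`WeierstrassCurve.formalFiltration` / `padicLimitLog` / `formalParameter` layer (Literature imports only);
nothing about any particular curve is asserted, nothing is booked, no mark / label / count / tier moves;
C-16 stays a CONJECTURE (data-suggested, never theorem). Consumer: the sibling
`Ordinary/PointDivisibilityFormalLevel.lean`, which reads these on `E(ℚ_p)` of a curve over `ℚ` at a good
non-anomalous odd `p` to prove that C-16's clause `m₃(P) = 0` (`¬ O5.PointLocallyThreeDivisibleAt W 3 P`,
hyp §120 C120.1) is the P-5 instruments' "formal level of `#Ẽ(𝔽₃)·P` is exactly `1`"
(`HOME/b2b-bsdres-additive-p3/R1-DEPTH-LAW.md` §1: `m_p = (level of #Ẽ(𝔽_p)·P) − 1`).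

## What is proved (`W/ℚ_p` `p`-integral, elliptic; `E⁽ᵏ⁾ = W.formalFiltration k`, `E⁽⁰⁾ = E⁽¹⁾ = E₁(ℚ_p)`)

* §1: `p·E⁽ᵏ⁾ ⊆ E⁽ᵏ⁺¹⁾` (all `p`; tree `norm_formalParameter_p_nsmul_le`); `E⁽ᵏ⁺¹⁾ ⊆ p·E⁽ᵏ⁾` for
  `k ≥ 2` (all `p`, via the tree's limit logarithm `L : E⁽ᵏ⁾ ≅ pᵏℤ_p`, AEC IV.6.4 (b) / VII.6.3); for
  `p` ODD the sharpened estimate **`‖z(pP) − p·z(P)‖ ≤ p⁻¹‖z(P)‖²`** on `E₁(ℚ_p)` (AEC IV.6.1's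
  `v(p) = 1 < p − 1`, through the tree's decomposition `[p](t) = p·f(t) + g(t^p)`,
  `formalMul_prime_eq_add_subst_X_pow`), whence `E⁽ᵏ⁺¹⁾ ⊆ p·E⁽ᵏ⁾` also for `k = 1`, and by induction
  **`E⁽ʲ⁺¹⁾ = p^j·E₁`**: a point of `E₁(ℚ_p)` is `p^j·Q` with `Q ∈ E₁(ℚ_p)` iff its level is `≥ j + 1`
  (`mem_formalFiltration_succ_iff_exists_pow_smul`). (At `p = 2` the step `k = 1` fails, as it must:
  `Ê(2ℤ₂) ≇ 2ℤ₂` in general; the generic bound `‖z(nP) − n·z(P)‖ ≤ ‖z(P)‖²`, tree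
  `norm_formalParameter_nsmul_sub_le`, is too weak at level `1`.)
* §2 (the `n`-trick): if `p ∤ n` and `n` maps `E(ℚ_p)` into `E₁(ℚ_p)`, then for EVERY `P ∈ E(ℚ_p)`:
  **`(∃ Q, p^j·Q = P) ⟺ n·P ∈ E⁽ʲ⁺¹⁾`** (Bézout for `gcd(n, p^j) = 1`). At a good non-anomalous `p` of a
  curve over `ℚ`, `n = #Ẽ(𝔽_p)` qualifies (AEC VII.2.1) — the consumer file.

References: J. H. Silverman, AEC 2nd ed. (2009), IV.3.2 (a), IV.4.4, IV.6.1, IV.6.4 (b), VII.2.1, VII.2.2,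
VII.6.3 [SilvermanAEC2009]; hyp `SHARPENED-CONJECTURES.md` §120 C120.1 / C120.2 (`m₃(P)`); additive-p3
`R1-DEPTH-LAW.md` §1–§2 (`m_p`).
-/

noncomputable section

open scoped Classical

open WeierstrassCurve Literature.NumberTheory.EllipticCurves

namespace Summit.BirchSwinnertonDyer.Rank1Residual.Ordinary


/-! ### §1 `E⁽ᵏ⁺¹⁾(ℚ_p) = p·E⁽ᵏ⁾(ℚ_p)` (`k ≥ 1`, `p` odd) -/

section Formal

variable {p : ℕ} [Fact p.Prime] (W : WeierstrassCurve ℚ_[p]) [hW : W.IsIntegral ℤ_[p]]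
  [W.IsElliptic]

/-- **`p·E⁽ᵏ⁾ ⊆ E⁽ᵏ⁺¹⁾`** (all `p`): `‖z(pP)‖ ≤ p⁻¹‖z(P)‖` on `E₁(ℚ_p)` (tree
`norm_formalParameter_p_nsmul_le`). [cite: SilvermanAEC2009, IV.3.2 (a) and VII.2.2] -/
theorem p_nsmul_mem_formalFiltration_succ {k : ℕ} {P : W.toAffine.Point}
    (hP : P ∈ W.formalFiltration k) : p • P ∈ W.formalFiltration (k + 1) := by
  refine ⟨W.isInReductionKernel_nsmul hP.1 p, ?_⟩
  calc ‖W.formalParameter (p • P)‖ ≤ (p : ℝ)⁻¹ * ‖W.formalParameter P‖ :=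
        W.norm_formalParameter_p_nsmul_le hP.1
    _ ≤ (p : ℝ)⁻¹ * ((p : ℝ)⁻¹) ^ k :=
        mul_le_mul_of_nonneg_left hP.2 (inv_nonneg.mpr (Nat.cast_nonneg p))
    _ = ((p : ℝ)⁻¹) ^ (k + 1) := by rw [pow_succ']

/-- Iterating: `P ∈ E⁽ᵏ⁾ ⟹ p^j·P ∈ E⁽ᵏ⁺ʲ⁾`. [cite: SilvermanAEC2009, IV.3.2 (a) and VII.2.2] -/
theorem pow_smul_mem_formalFiltration_add {k : ℕ} {P : W.toAffine.Point}
    (hP : P ∈ W.formalFiltration k) (j : ℕ) : p ^ j • P ∈ W.formalFiltration (k + j) := by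
  induction j with
  | zero => rwa [pow_zero, one_smul, add_zero]
  | succ j ih =>
    rw [pow_succ', ← smul_smul, ← add_assoc]
    exact p_nsmul_mem_formalFiltration_succ W ih

/-- `L(n·Q) = n·L(Q)` on `E⁽ᵏ⁾`, `k ≥ 2` (additivity of the tree's limit logarithm there). [folklore] -/
theorem padicLimitLog_nsmul_of_mem {k : ℕ} (hk : 2 ≤ k) {Q : W.toAffine.Point}
    (hQ : Q ∈ W.formalFiltration k) (n : ℕ) :
    W.padicLimitLog (n • Q) = (n : ℚ_[p]) * W.padicLimitLog Q := by
  induction n with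
  | zero => rw [zero_nsmul, W.padicLimitLog_zero, Nat.cast_zero, zero_mul]
  | succ n ih =>
    rw [succ_nsmul, W.padicLimitLog_add_of_mem hk (AddSubgroup.nsmul_mem _ hQ n) hQ, ih,
      Nat.cast_succ]
    ring

/-- **`E⁽ᵏ⁺¹⁾ ⊆ p·E⁽ᵏ⁾` for `k ≥ 2`** (all `p`): with the tree's limit logarithm `L`, an isomorphism
`E⁽ᵏ⁾ ≅ pᵏℤ_p` for `k ≥ 2` (`exists_mem_padicLimitLog_eq`, `‖L(P)‖ = ‖z(P)‖`, injectivity), the point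
`Q ∈ E⁽ᵏ⁾` with `L(Q) = L(R)/p` satisfies `p·Q = R`. [cite: SilvermanAEC2009, IV.6.4 (b) and VII.2.2] -/
theorem exists_p_nsmul_eq_of_mem_formalFiltration_succ_of_two_le {k : ℕ} (hk : 2 ≤ k)
    {R : W.toAffine.Point} (hR : R ∈ W.formalFiltration (k + 1)) :
    ∃ Q ∈ W.formalFiltration k, p • Q = R := by
  have hp : p.Prime := Fact.out
  have hp0 : (p : ℚ_[p]) ≠ 0 := Nat.cast_ne_zero.mpr hp.ne_zero
  have hpR : (0 : ℝ) < (p : ℝ)⁻¹ := inv_pos.mpr (by exact_mod_cast hp.pos)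
  have hRk : R ∈ W.formalFiltration k := W.formalFiltration_antitone (Nat.le_succ k) hR
  -- `t = L(R)/p` has `‖t‖ ≤ p^{-k}`
  set t : ℚ_[p] := W.padicLimitLog R / p with ht
  have hLR : ‖W.padicLimitLog R‖ ≤ ((p : ℝ)⁻¹) ^ (k + 1) := by
    rw [W.norm_padicLimitLog_of_mem (by omega : 2 ≤ k + 1) hR]
    exact hR.2
  have htn : ‖t‖ ≤ ((p : ℝ)⁻¹) ^ k := by
    rw [ht, norm_div, Padic.norm_p, div_le_iff₀ hpR, ← pow_succ]
    exact hLR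
  obtain ⟨Q, hQ, hLQ⟩ := W.exists_mem_padicLimitLog_eq hk htn
  refine ⟨Q, hQ, ?_⟩
  have hpQ : p • Q ∈ W.formalFiltration k := AddSubgroup.nsmul_mem _ hQ p
  have hpt : (p : ℚ_[p]) * t = W.padicLimitLog R := by
    rw [ht, mul_div_cancel₀ _ hp0]
  have hdiff : W.padicLimitLog (p • Q - R) = 0 := by
    rw [W.padicLimitLog_sub_of_mem hk hpQ hRk, padicLimitLog_nsmul_of_mem W hk hQ p, hLQ, hpt,
      sub_self]
  exact sub_eq_zero.mp (W.eq_zero_of_padicLimitLog_eq_zero hk (sub_mem hpQ hRk) hdiff)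

omit [W.IsElliptic] in
/-- **AEC IV.6.1 sharpened for `p` odd: `‖z(pP) − p·z(P)‖ ≤ p⁻¹·‖z(P)‖²` on `E₁(ℚ_p)`.** Writing
`[p](t) = p·f(t) + g(t^p)` with `f, g ∈ ℤ_p⟦t⟧`, `f(t) = t + h(t)`, `h = O(t²)`, `g(0) = 0` (the tree's
`formalMul_prime_eq_add_subst_X_pow`): `z(pP) − p·z(P) = p·h(z) + g(z^p)` with `‖p·h(z)‖ ≤ p⁻¹‖z‖²` and
`‖g(z^p)‖ ≤ ‖z‖^p = ‖z‖^{p−2}·‖z‖² ≤ p^{−(p−2)}‖z‖² ≤ p⁻¹‖z‖²` (`‖z‖ ≤ p⁻¹`, `p ≥ 3`). (The generic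
bound, tree `norm_formalParameter_nsmul_sub_le`, is `‖z‖²` only — too weak at level `1`; at `p = 2` the
sharpening is false.) [cite: SilvermanAEC2009, IV.6.1 and IV.4.4] -/
theorem norm_formalParameter_p_nsmul_sub_le_of_ne_two (hp2 : p ≠ 2) {P : W.toAffine.Point}
    (hP : W.IsInReductionKernel P) :
    ‖W.formalParameter (p • P) - (p : ℚ_[p]) * W.formalParameter P‖ ≤
      (p : ℝ)⁻¹ * ‖W.formalParameter P‖ ^ 2 := by
  have hp : p.Prime := Fact.out
  have hz1 : ‖W.formalParameter P‖ < 1 := W.norm_formalParameter_lt_one hP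
  have hzp : ‖W.formalParameter P‖ ≤ (p : ℝ)⁻¹ := W.norm_formalParameter_le_inv hP
  have hp0 : (0 : ℝ) < (p : ℝ)⁻¹ := inv_pos.mpr (by exact_mod_cast hp.pos)
  have hp3 : 3 ≤ p := by
    rcases hp.eq_two_or_odd' with h | h
    · exact absurd h hp2
    · exact Nat.succ_le_of_lt (lt_of_le_of_ne hp.two_le (fun h2 => hp2 h2.symm))
  set z := W.formalParameter P with hzdef
  -- the decomposition `[p] = p f + g(t^p)`, `f = t + h`
  have hf : IsPadicInt W.formalMulPRemPart := W.isPadicInt_formalMulPRemPart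
  have hg : IsPadicInt W.formalMulPDivPart := W.isPadicInt_formalMulPDivPart
  have hh : IsPadicInt (W.formalMulPRemPart - PowerSeries.X) := hf.sub IsPadicInt.powerSeries_X
  have hf0 : PowerSeries.constantCoeff W.formalMulPRemPart = 0 := by
    rw [formalMulPRemPart, ← PowerSeries.coeff_zero_eq_constantCoeff_apply, PowerSeries.coeff_mk,
      if_pos (dvd_zero p)]
  have hf1 : PowerSeries.coeff 1 W.formalMulPRemPart = 1 := by
    have hp1 : ¬ p ∣ 1 := fun h => hp.one_lt.ne' (Nat.dvd_one.mp h)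
    rw [formalMulPRemPart, PowerSeries.coeff_mk, if_neg hp1, W.coeff_one_formalMul,
      inv_mul_cancel₀ (Nat.cast_ne_zero.mpr hp.ne_zero)]
  have hh0 : PowerSeries.constantCoeff (W.formalMulPRemPart - PowerSeries.X) = 0 := by
    rw [map_sub, hf0, PowerSeries.constantCoeff_X, sub_zero]
  have hh1 : PowerSeries.coeff 1 (W.formalMulPRemPart - PowerSeries.X) = 0 := by
    rw [map_sub, hf1, PowerSeries.coeff_one_X, sub_self]
  have hXp : IsPadicInt ((PowerSeries.X : PowerSeries ℚ_[p]) ^ p) := IsPadicInt.powerSeries_X.pow p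
  have hXp0 : PowerSeries.constantCoeff ((PowerSeries.X : PowerSeries ℚ_[p]) ^ p) = 0 := by
    rw [map_pow, PowerSeries.constantCoeff_X, zero_pow hp.ne_zero]
  have hCp : IsPadicInt (PowerSeries.C (p : ℚ_[p])) :=
    IsPadicInt.C (by simpa using Padic.norm_int_le_one (p := p) (p : ℤ))
  have hgs : IsPadicInt (W.formalMulPDivPart.subst ((PowerSeries.X : PowerSeries ℚ_[p]) ^ p)) :=
    hg.powerSeries_subst hXp (PowerSeries.HasSubst.X_pow hp.ne_zero)
  have hfX : W.formalMulPRemPart = PowerSeries.X + (W.formalMulPRemPart - PowerSeries.X) := by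
    ring
  have heval : W.formalParameter (p • P) =
      (p : ℚ_[p]) * z + ((p : ℚ_[p]) * padicEval (W.formalMulPRemPart - PowerSeries.X) z +
        padicEval W.formalMulPDivPart (z ^ p)) := by
    rw [← W.padicEval_formalMul_formalParameter p hP, W.formalMul_prime_eq_add_subst_X_pow,
      padicEval_add (hCp.mul hf) hgs hz1, padicEval_mul hCp hf hz1, padicEval_C,
      padicEval_subst hg hXp hXp0 hz1, padicEval_pow IsPadicInt.powerSeries_X hz1, padicEval_X]
    conv_lhs => rw [hfX, padicEval_add IsPadicInt.powerSeries_X hh hz1, padicEval_X]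
    ring
  -- the two error terms are `≤ p⁻¹ ‖z‖²`
  have h1 : ‖(p : ℚ_[p]) * padicEval (W.formalMulPRemPart - PowerSeries.X) z‖ ≤
      (p : ℝ)⁻¹ * ‖z‖ ^ 2 := by
    rw [norm_mul, Padic.norm_p]
    exact mul_le_mul_of_nonneg_left (norm_padicEval_le_sq hh hh0 hh1 hz1) hp0.le
  have h2 : ‖padicEval W.formalMulPDivPart (z ^ p)‖ ≤ (p : ℝ)⁻¹ * ‖z‖ ^ 2 := by
    have hzp1 : ‖z ^ p‖ < 1 := by
      rw [norm_pow]; exact pow_lt_one₀ (norm_nonneg _) hz1 hp.ne_zero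
    calc ‖padicEval W.formalMulPDivPart (z ^ p)‖ ≤ ‖z ^ p‖ :=
          norm_padicEval_le hg W.constantCoeff_formalMulPDivPart hzp1
      _ = ‖z‖ ^ (p - 2) * ‖z‖ ^ 2 := by
          rw [norm_pow, ← pow_add, Nat.sub_add_cancel (by omega : 2 ≤ p)]
      _ ≤ ((p : ℝ)⁻¹) ^ (p - 2) * ‖z‖ ^ 2 :=
          mul_le_mul_of_nonneg_right (pow_le_pow_left₀ (norm_nonneg _) hzp _) (sq_nonneg _)
      _ ≤ (p : ℝ)⁻¹ * ‖z‖ ^ 2 := by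
          refine mul_le_mul_of_nonneg_right ?_ (sq_nonneg _)
          calc ((p : ℝ)⁻¹) ^ (p - 2) ≤ ((p : ℝ)⁻¹) ^ 1 :=
                pow_le_pow_of_le_one hp0.le
                  (inv_le_one_of_one_le₀ (by exact_mod_cast hp.one_lt.le)) (by omega)
            _ = (p : ℝ)⁻¹ := pow_one _
  rw [heval, add_sub_cancel_left]
  exact (Padic.nonarchimedean _ _).trans (max_le h1 h2)

/-- **One step, `p` odd, `k ≥ 1`: for `R ∈ E⁽ᵏ⁺¹⁾` the point `P ∈ E⁽ᵏ⁾` with `z(P) = z(R)/p` (inverse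
dictionary, AEC VII.2.2) has `R − p·P ∈ E⁽ᵏ⁺²⁾`** (`‖z(R − pP)‖ ≤ ‖z(R) − z(pP)‖ = ‖p·z(P) − z(pP)‖ ≤
p⁻¹‖z(P)‖² ≤ p^{−(2k+1)} ≤ p^{−(k+2)}`). [cite: SilvermanAEC2009, IV.6.1 and VII.2.2] -/
theorem exists_sub_p_nsmul_mem_formalFiltration_add_two (hp2 : p ≠ 2) {k : ℕ} (hk : 1 ≤ k)
    {R : W.toAffine.Point} (hR : R ∈ W.formalFiltration (k + 1)) :
    ∃ P ∈ W.formalFiltration k, R - p • P ∈ W.formalFiltration (k + 1 + 1) := by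
  have hp : p.Prime := Fact.out
  have hp0 : (p : ℚ_[p]) ≠ 0 := Nat.cast_ne_zero.mpr hp.ne_zero
  have hpR : (0 : ℝ) < (p : ℝ)⁻¹ := inv_pos.mpr (by exact_mod_cast hp.pos)
  have hp1 : (p : ℝ)⁻¹ < 1 := inv_lt_one_of_one_lt₀ (by exact_mod_cast hp.one_lt)
  -- the parameter `z(R)/p`
  set s : ℚ_[p] := W.formalParameter R / p with hs
  have hsn : ‖s‖ ≤ ((p : ℝ)⁻¹) ^ k := by
    rw [hs, norm_div, Padic.norm_p, div_le_iff₀ hpR, ← pow_succ]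
    exact hR.2
  have hs1 : ‖s‖ < 1 := hsn.trans_lt (pow_lt_one₀ hpR.le hp1 (by omega))
  obtain ⟨P, hP1, hPs⟩ := W.exists_isInReductionKernel_formalParameter_eq hs1
  have hPk : P ∈ W.formalFiltration k := ⟨hP1, by rw [hPs]; exact hsn⟩
  refine ⟨P, hPk, ?_⟩
  have hpP : W.IsInReductionKernel (p • P) := W.isInReductionKernel_nsmul hP1 p
  have hsub0 : R - p • P ∈ W.formalFiltration 0 :=
    sub_mem (W.formalFiltration_antitone (Nat.zero_le _) hR) (W.mem_formalFiltration_zero_iff.mpr hpP)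
  refine ⟨hsub0.1, ?_⟩
  have hzR : (p : ℚ_[p]) * W.formalParameter P = W.formalParameter R := by
    rw [hPs, hs, mul_div_cancel₀ _ hp0]
  calc ‖W.formalParameter (R - p • P)‖
      ≤ ‖W.formalParameter R - W.formalParameter (p • P)‖ := W.norm_formalParameter_sub_le hR.1 hpP
    _ = ‖W.formalParameter (p • P) - (p : ℚ_[p]) * W.formalParameter P‖ := by
        rw [← hzR, norm_sub_rev]
    _ ≤ (p : ℝ)⁻¹ * ‖W.formalParameter P‖ ^ 2 :=
        norm_formalParameter_p_nsmul_sub_le_of_ne_two W hp2 hP1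
    _ ≤ (p : ℝ)⁻¹ * (((p : ℝ)⁻¹) ^ k) ^ 2 :=
        mul_le_mul_of_nonneg_left (pow_le_pow_left₀ (norm_nonneg _) hPk.2 2) hpR.le
    _ = ((p : ℝ)⁻¹) ^ (k * 2 + 1) := by rw [← pow_mul, ← pow_succ']
    _ ≤ ((p : ℝ)⁻¹) ^ (k + 1 + 1) := pow_le_pow_of_le_one hpR.le hp1.le (by omega)

/-- **`E⁽ᵏ⁺¹⁾ ⊆ p·E⁽ᵏ⁾` for every `k ≥ 1`, `p` odd** (one step, then the `k ≥ 2` case absorbs the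
remainder `R − pP ∈ E⁽ᵏ⁺²⁾ = p·E⁽ᵏ⁺¹⁾`). With `p_nsmul_mem_formalFiltration_succ`:
`E⁽ᵏ⁺¹⁾ = p·E⁽ᵏ⁾`, AEC IV.6.4 (b)'s `Ê(pᵏℤ_p) ≅ pᵏℤ_p` (`k ≥ 1`, `p > 2`) in divisibility form.
[cite: SilvermanAEC2009, IV.6.4 (b) and VII.2.2] -/
theorem exists_p_nsmul_eq_of_mem_formalFiltration_succ (hp2 : p ≠ 2) {k : ℕ} (hk : 1 ≤ k)
    {R : W.toAffine.Point} (hR : R ∈ W.formalFiltration (k + 1)) :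
    ∃ Q ∈ W.formalFiltration k, p • Q = R := by
  obtain ⟨P, hP, hrem⟩ := exists_sub_p_nsmul_mem_formalFiltration_add_two W hp2 hk hR
  obtain ⟨Q', hQ', hpQ'⟩ :=
    exists_p_nsmul_eq_of_mem_formalFiltration_succ_of_two_le W (by omega : 2 ≤ k + 1) hrem
  refine ⟨P + Q', add_mem hP (W.formalFiltration_antitone (Nat.le_succ k) hQ'), ?_⟩
  rw [nsmul_add, hpQ', add_sub_cancel]

/-- **`E⁽ʲ⁺¹⁾ ⊆ p^j·E₁`** (`p` odd): every `R ∈ E⁽ʲ⁺¹⁾` is `p^j·Q` with `Q ∈ E₁(ℚ_p) = E⁽¹⁾`.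
[cite: SilvermanAEC2009, IV.6.4 (b) and VII.2.2] -/
theorem exists_pow_smul_eq_of_mem_formalFiltration_succ (hp2 : p ≠ 2) (j : ℕ)
    {R : W.toAffine.Point} (hR : R ∈ W.formalFiltration (j + 1)) :
    ∃ Q ∈ W.formalFiltration 1, p ^ j • Q = R := by
  induction j generalizing R with
  | zero => exact ⟨R, by simpa using hR, by rw [pow_zero, one_smul]⟩
  | succ j ih =>
    obtain ⟨Q₁, hQ₁, hpQ₁⟩ := exists_p_nsmul_eq_of_mem_formalFiltration_succ W hp2 (by omega) hR
    obtain ⟨Q, hQ, hQQ₁⟩ := ih hQ₁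
    exact ⟨Q, hQ, by rw [pow_succ', ← smul_smul, hQQ₁, hpQ₁]⟩

/-- **`E⁽ʲ⁺¹⁾ = p^j·E₁` (`p` odd): a point `R ∈ E₁(ℚ_p)` has level `≥ j + 1` iff it is `p^j·Q` for
some `Q ∈ E₁(ℚ_p)`** (`E₁ = E⁽⁰⁾ = E⁽¹⁾`, tree `formalFiltration_one_eq_zero`).
[cite: SilvermanAEC2009, IV.6.4 (b) and VII.2.2] -/
theorem mem_formalFiltration_succ_iff_exists_pow_smul (hp2 : p ≠ 2) (j : ℕ) (R : W.toAffine.Point) :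
    R ∈ W.formalFiltration (j + 1) ↔
      ∃ Q : W.toAffine.Point, W.IsInReductionKernel Q ∧ p ^ j • Q = R := by
  constructor
  · intro hR
    obtain ⟨Q, hQ, hQR⟩ := exists_pow_smul_eq_of_mem_formalFiltration_succ W hp2 j hR
    exact ⟨Q, hQ.1, hQR⟩
  · rintro ⟨Q, hQ, rfl⟩
    have hQ1 : Q ∈ W.formalFiltration 1 := by
      rw [W.formalFiltration_one_eq_zero]
      exact W.mem_formalFiltration_zero_iff.mpr hQ
    have h := pow_smul_mem_formalFiltration_add W hQ1 j
    rwa [add_comm] at h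

end Formal

/-! ### §2 The `n`-trick: `p`-divisibility in all of `E(ℚ_p)` read on `n·P ∈ E₁(ℚ_p)` -/

section Trick

/-- Bézout descent in an abelian group: `m • y = n • x` with `gcd(n, m) = 1` gives `x ∈ m·G`
(`x = (a n + b m) • x = m • (a • y + b • x)`). [folklore] -/
private theorem exists_smul_eq_of_smul_eq_smul_of_coprime {G : Type*} [AddCommGroup G] {m n : ℕ}
    (hcop : Nat.Coprime n m) {x y : G} (h : m • y = n • x) : ∃ z : G, m • z = x := by
  have hbez : (n : ℤ) * Nat.gcdA n m + (m : ℤ) * Nat.gcdB n m = 1 := by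
    rw [← Nat.gcd_eq_gcd_ab, hcop.gcd_eq_one, Nat.cast_one]
  refine ⟨Nat.gcdA n m • y + Nat.gcdB n m • x, ?_⟩
  calc m • (Nat.gcdA n m • y + Nat.gcdB n m • x)
      = Nat.gcdA n m • (m • y) + Nat.gcdB n m • (m • x) := by
        rw [smul_add, smul_comm _ (Nat.gcdA n m), smul_comm _ (Nat.gcdB n m)]
    _ = ((n : ℤ) * Nat.gcdA n m + (m : ℤ) * Nat.gcdB n m) • x := by
        rw [h, add_smul, mul_comm (n : ℤ), mul_comm (m : ℤ), mul_smul, mul_smul, natCast_zsmul,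
          natCast_zsmul]
    _ = x := by rw [hbez, one_smul]

variable {p : ℕ} [Fact p.Prime] (W : WeierstrassCurve ℚ_[p]) [hW : W.IsIntegral ℤ_[p]]
  [W.IsElliptic]

/-- **If `p ∤ n` and `n·E(ℚ_p) ⊆ E₁(ℚ_p)`, then `P ∈ p^j·E(ℚ_p) ⟺ n·P ∈ E⁽ʲ⁺¹⁾(ℚ_p)`** (`p` odd):
`⟹` by `n·(p^j·Q) = p^j·(n·Q)` with `n·Q ∈ E₁`; `⟸` by §1 (`n·P = p^j·Q₁`, `Q₁ ∈ E₁`) and Bézout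
`a·n + b·p^j = 1`: `P = p^j·(a·Q₁ + b·P)`. [cite: SilvermanAEC2009, IV.6.4 (b) and VII.2.1] -/
theorem exists_pow_smul_eq_iff_nsmul_mem_formalFiltration (hp2 : p ≠ 2) {n : ℕ} (hn : ¬ p ∣ n)
    (hker : ∀ Q : W.toAffine.Point, W.IsInReductionKernel (n • Q)) (P : W.toAffine.Point) (j : ℕ) :
    (∃ Q : W.toAffine.Point, p ^ j • Q = P) ↔ n • P ∈ W.formalFiltration (j + 1) := by
  have hp : p.Prime := Fact.out
  rw [mem_formalFiltration_succ_iff_exists_pow_smul W hp2 j]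
  constructor
  · rintro ⟨Q, rfl⟩
    exact ⟨n • Q, hker Q, nsmul_left_comm Q n (p ^ j)⟩
  · rintro ⟨Q₁, -, hQ₁⟩
    have hcop : Nat.Coprime n (p ^ j) :=
      Nat.Coprime.pow_right _ ((Nat.Prime.coprime_iff_not_dvd hp).mpr hn).symm
    exact exists_smul_eq_of_smul_eq_smul_of_coprime hcop hQ₁

end Trick

end Summit.BirchSwinnertonDyer.Rank1Residual.Ordinary

end
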